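import Summits.RiemannHypothesis.RiemannHypothesis.Theorems.SignConeConeMagnificationStubContinuation
import Summits.RiemannHypothesis.RiemannHypothesis.Theorems.SignConeExactConeRigidityDirichlet

/-!
# Route SignCone, item `ExactConeRigidity` (stmt-RiemannHypothesis-16306): ONE holomorphic continuation of
`L_c(s) - 1/(s-1)` to the half-plane `Re s > 1/2` for unit-slack (in particular exact) cone weights

For a weight `c ≥ 0` with unit slack against every Weil test (the exact cone of this item is contained in the
unit-slack cone, `unitSlack_of_exact`), the tree already continues `s ↦ L_c(s) M_G(s) - M_G(1)/(s-1)` to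
`Re s > 1/2` for every window `g` (`G = g ⋆ g̃`, `M_G = weilMellin G`): it is the Laplace side
`ℜ_g(s - 1/2)` of `SignCone.LSeries_mul_weilMellin_sub_pole_eq` / `SignCone.differentiableOn_contRHS`, and
`stub_continuation` divides by `M_G` on thin rectangles.  Here the rectangles are GLUED: the numerators
`N_g(s) := ℜ_g(s - 1/2) - dslope M_G 1 s` (holomorphic on the half-plane, `= (L_c(s) - 1/(s-1)) M_G(s)` on
`Re s > 1`) satisfy the cross identity `N_{g₁} M_{G₂} = N_{g₂} M_{G₁}` on the whole half-plane (identity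
theorem on a convex open set), so `F := N_g / M_G` does not depend on the window wherever `M_G ≠ 0`, and windows
with `M_G ≠ 0` near any prescribed point exist (`exists_rect_weilMellin_ne_zero`).  Result
(`exists_continuation_halfPlane`): ONE `F`, holomorphic on `Re s > 1/2`, with `F = L_c - 1/(s-1)` on `Re s > 1`
and the window identity `ℜ_g(s - 1/2) = F(s) M_G(s) + dslope M_G 1 s` for EVERY window `g` and every
`Re s > 1/2` — the form in which the Carathéodory majorant is transported to `1/2 < Re s ≤ 1`
(`SignConeExactConeRigidityCara.lean`).
-/

noncomputable section

-- `Summit.RiemannHypothesis.RiemannHypothesis.…` repeats a namespace component by design (D-0017 layout).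
set_option linter.dupNamespace false

open scoped BigOperators ComplexConjugate Real Topology
open Complex MeasureTheory Set Filter Metric LSeries

namespace Summit.RiemannHypothesis.RiemannHypothesis.Theorems.SignConeExactConeRigidity

open Literature.NumberTheory.LFunctions
open Summit.RiemannHypothesis.RiemannHypothesis.Theorems.SignCone
open Summit.RiemannHypothesis.RiemannHypothesis.Cruxes.ConeMagnification.Sketch

variable {c : ℕ → ℝ}

/-- The Laplace side `ℜ_g(z) = ∫₀^∞ u_g(x) e^{-zx} dx - Fin_{g,N}(z)` of the continuation identity
`SignCone.LSeries_mul_weilMellin_sub_pole_eq` for the window `g` (`G = g ⋆ g̃`, `u_g(x) = P_c(G(· - x)) - e^{x/2} M_G(1)`,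
`N` boundary terms), as a function of `z` (holomorphic on `Re z > 0`, `SignCone.differentiableOn_contRHS`). -/
local notation3 (prettyPrint := false) "ℜ[" c ", " g ", " N ", " z "]" =>
  (∫ x in Ioi (0 : ℝ), ((∑' n : ℕ, ((c n : ℝ) : ℂ) / (Real.sqrt n : ℂ) *
      (weilConv g (weilReflect g) (Real.log n - x) + weilConv g (weilReflect g) (-Real.log n - x))) -
        cexp ((x : ℂ) / 2) * weilMellin (weilConv g (weilReflect g)) 1) * cexp (-(z * x))) -
    ∑ n ∈ Finset.range N, ((c n : ℝ) : ℂ) / (Real.sqrt n : ℂ) *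
      ((∫ x in Ioi (0 : ℝ), (weilConv g (weilReflect g) (Real.log n - x) +
          weilConv g (weilReflect g) (-Real.log n - x)) * cexp (-(z * x))) -
        cexp (-(z * Real.log n)) * weilMellin (weilConv g (weilReflect g)) (z + 1 / 2))

/-! ## The numerators `N_g(s) = ℜ_g(s - 1/2) - dslope M_G 1 s` -/

/-- `dslope M_G 1` is entire (`M_G` is entire). -/
theorem differentiable_dslope_weilMellin {G : ℝ → ℂ} (hG : IsWeilTest G) :
    Differentiable ℂ (dslope (weilMellin G) 1) := by
  have hMGd : Differentiable ℂ (weilMellin G) := differentiable_weilMellin hG.1.continuous hG.2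
  intro s
  rcases eq_or_ne s 1 with rfl | hs
  · obtain ⟨p, hp⟩ := hMGd.analyticAt 1
    exact hp.has_fpower_series_dslope_fslope.analyticAt.differentiableAt
  · exact (differentiableAt_dslope_of_ne hs).2 (hMGd s)

/-- **The numerator of a window is holomorphic on the half-plane.**  For `c ≥ 0` with unit slack against every
Weil test and a window `g` (`tsupport g ⊆ [-a, a]`), `N_g(s) = ℜ_g(s - 1/2) - dslope M_G 1 s` is holomorphic on
`Re s > 1/2` (`SignCone.differentiableOn_contRHS`). -/
theorem differentiableOn_numerator
    (hU : ∀ φ : ℝ → ℂ, IsWeilTest φ →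
      -(∫ t, ‖φ t‖ ^ 2) ≤
        (weilPolarTerm (weilConv φ (weilReflect φ)) + weilArchTerm (weilConv φ (weilReflect φ)) -
          ∑' n : ℕ, ((c n : ℝ) : ℂ) / (Real.sqrt n : ℂ) *
            (weilConv φ (weilReflect φ) (Real.log n) + weilConv φ (weilReflect φ) (-Real.log n))).re)
    {g : ℝ → ℂ} {a : ℝ} (hg : IsWeilTest g) (hsupp : tsupport g ⊆ Icc (-a) a) (N : ℕ) :
    DifferentiableOn ℂ (fun s : ℂ => ℜ[c, g, N, s - 1 / 2] - dslope (weilMellin (weilConv g (weilReflect g))) 1 s)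
      {s : ℂ | 1 / 2 < s.re} := by
  have hR := differentiableOn_contRHS hU hg hsupp N
  refine DifferentiableOn.sub ?_ (differentiable_dslope_weilMellin (hg.weilConv hg.weilReflect)).differentiableOn
  refine hR.comp (by fun_prop) fun s hs => ?_
  show 0 < (s - 1 / 2).re
  have : 1 / 2 < s.re := hs
  simp; linarith

/-- **The numerator on `Re s > 1`.**  For `c ≥ 0` with unit slack, a window `g` with `tsupport g ⊆ [-a, a]`
(`a ≥ 0`), `N = ⌊e^{2a}⌋ + 1` and `Re s > 1`: `N_g(s) = (L_c(s) - 1/(s-1)) M_G(s)`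
(`SignCone.LSeries_mul_weilMellin_sub_pole_eq` at `z = s - 1/2`, `LSeriesSummable_of_unitSlack`). -/
theorem numerator_eq_of_one_lt
    (hU : ∀ φ : ℝ → ℂ, IsWeilTest φ →
      -(∫ t, ‖φ t‖ ^ 2) ≤
        (weilPolarTerm (weilConv φ (weilReflect φ)) + weilArchTerm (weilConv φ (weilReflect φ)) -
          ∑' n : ℕ, ((c n : ℝ) : ℂ) / (Real.sqrt n : ℂ) *
            (weilConv φ (weilReflect φ) (Real.log n) + weilConv φ (weilReflect φ) (-Real.log n))).re)
    (hc : ∀ n, 0 ≤ c n) {g : ℝ → ℂ} {a : ℝ} (hg : IsWeilTest g) (ha : 0 ≤ a) (hsupp : tsupport g ⊆ Icc (-a) a)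
    {s : ℂ} (hs : 1 < s.re) :
    ℜ[c, g, ⌊Real.exp (2 * a)⌋₊ + 1, s - 1 / 2] - dslope (weilMellin (weilConv g (weilReflect g))) 1 s =
      (LSeries (fun n => ((c n : ℝ) : ℂ)) s - 1 / (s - 1)) * weilMellin (weilConv g (weilReflect g)) s := by
  set MG : ℂ → ℂ := weilMellin (weilConv g (weilReflect g)) with hMG
  have hsre : 1 / 2 < (s - 1 / 2).re := by simp; linarith
  have hsum : LSeriesSummable (fun n => ((c n : ℝ) : ℂ)) (((s - 1 / 2).re + 1 / 2 : ℝ) : ℂ) := by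
    have h := LSeriesSummable_of_unitSlack hU hc (σ := s.re) hs
    have e : (((s - 1 / 2).re + 1 / 2 : ℝ) : ℂ) = (s.re : ℂ) := by congr 1; simp
    rw [e]; exact h
  have hid := LSeries_mul_weilMellin_sub_pole_eq hU hc hg ha hsupp hsre hsum
  have e1 : s - 1 / 2 + 1 / 2 = s := by ring
  have e2 : s - 1 / 2 - 1 / 2 = s - 1 := by ring
  have hs1' : s - 1 ≠ 0 := by
    intro h
    have := congrArg Complex.re h
    simp at this
    linarith
  have hsne : s ≠ 1 := fun h => hs1' (by rw [h, sub_self])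
  have hdsl : dslope MG 1 s = (MG s - MG 1) / (s - 1) := by
    rw [dslope_of_ne _ hsne, slope_def_field]
  change ℜ[c, g, ⌊Real.exp (2 * a)⌋₊ + 1, s - 1 / 2] - dslope MG 1 s = (LSeries (fun n => ((c n : ℝ) : ℂ)) s - 1 / (s - 1)) * MG s
  rw [hdsl]
  have hR : ℜ[c, g, ⌊Real.exp (2 * a)⌋₊ + 1, s - 1 / 2] =
      LSeries (fun n => ((c n : ℝ) : ℂ)) (s - 1 / 2 + 1 / 2) * MG (s - 1 / 2 + 1 / 2) - MG 1 / (s - 1 / 2 - 1 / 2) :=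
    hid.symm
  rw [hR, e1, e2]
  field_simp
  ring

/-- **The cross identity.**  For two windows `g₁, g₂` of a unit-slack weight,
`N_{g₁}(s) M_{G₂}(s) = N_{g₂}(s) M_{G₁}(s)` on the whole half-plane `Re s > 1/2`: both sides are holomorphic
there and agree (with `(L_c - 1/(s-1)) M_{G₁} M_{G₂}`) on `Re s > 1` (identity theorem on the convex half-plane). -/
theorem numerator_cross
    (hU : ∀ φ : ℝ → ℂ, IsWeilTest φ →
      -(∫ t, ‖φ t‖ ^ 2) ≤
        (weilPolarTerm (weilConv φ (weilReflect φ)) + weilArchTerm (weilConv φ (weilReflect φ)) -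
          ∑' n : ℕ, ((c n : ℝ) : ℂ) / (Real.sqrt n : ℂ) *
            (weilConv φ (weilReflect φ) (Real.log n) + weilConv φ (weilReflect φ) (-Real.log n))).re)
    (hc : ∀ n, 0 ≤ c n) {g₁ g₂ : ℝ → ℂ} {a₁ a₂ : ℝ} (hg₁ : IsWeilTest g₁) (ha₁ : 0 ≤ a₁)
    (hsupp₁ : tsupport g₁ ⊆ Icc (-a₁) a₁) (hg₂ : IsWeilTest g₂) (ha₂ : 0 ≤ a₂) (hsupp₂ : tsupport g₂ ⊆ Icc (-a₂) a₂)
    {s : ℂ} (hs : 1 / 2 < s.re) :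
    (ℜ[c, g₁, ⌊Real.exp (2 * a₁)⌋₊ + 1, s - 1 / 2] - dslope (weilMellin (weilConv g₁ (weilReflect g₁))) 1 s) *
        weilMellin (weilConv g₂ (weilReflect g₂)) s =
      (ℜ[c, g₂, ⌊Real.exp (2 * a₂)⌋₊ + 1, s - 1 / 2] - dslope (weilMellin (weilConv g₂ (weilReflect g₂))) 1 s) *
        weilMellin (weilConv g₁ (weilReflect g₁)) s := by
  set U : Set ℂ := {s : ℂ | 1 / 2 < s.re} with hUdef
  have hUo : IsOpen U := isOpen_lt continuous_const Complex.continuous_re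
  have hUc : IsPreconnected U := (convex_halfSpace_re_gt (1 / 2)).isPreconnected
  have hM₁ : Differentiable ℂ (weilMellin (weilConv g₁ (weilReflect g₁))) :=
    differentiable_weilMellin (hg₁.weilConv hg₁.weilReflect).1.continuous (hg₁.weilConv hg₁.weilReflect).2
  have hM₂ : Differentiable ℂ (weilMellin (weilConv g₂ (weilReflect g₂))) :=
    differentiable_weilMellin (hg₂.weilConv hg₂.weilReflect).1.continuous (hg₂.weilConv hg₂.weilReflect).2
  have hN₁ := differentiableOn_numerator hU hg₁ hsupp₁ (⌊Real.exp (2 * a₁)⌋₊ + 1)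
  have hN₂ := differentiableOn_numerator hU hg₂ hsupp₂ (⌊Real.exp (2 * a₂)⌋₊ + 1)
  have hL : AnalyticOnNhd ℂ (fun s : ℂ =>
      (ℜ[c, g₁, ⌊Real.exp (2 * a₁)⌋₊ + 1, s - 1 / 2] - dslope (weilMellin (weilConv g₁ (weilReflect g₁))) 1 s) *
        weilMellin (weilConv g₂ (weilReflect g₂)) s) U :=
    (hN₁.mul hM₂.differentiableOn).analyticOnNhd hUo
  have hR : AnalyticOnNhd ℂ (fun s : ℂ =>
      (ℜ[c, g₂, ⌊Real.exp (2 * a₂)⌋₊ + 1, s - 1 / 2] - dslope (weilMellin (weilConv g₂ (weilReflect g₂))) 1 s) *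
        weilMellin (weilConv g₁ (weilReflect g₁)) s) U :=
    (hN₂.mul hM₁.differentiableOn).analyticOnNhd hUo
  have h2 : (2 : ℂ) ∈ U := by simp [hUdef]; norm_num
  -- near `s = 2` both sides equal `(L_c - 1/(s-1)) M₁ M₂`
  have hev : (fun s : ℂ =>
      (ℜ[c, g₁, ⌊Real.exp (2 * a₁)⌋₊ + 1, s - 1 / 2] - dslope (weilMellin (weilConv g₁ (weilReflect g₁))) 1 s) *
        weilMellin (weilConv g₂ (weilReflect g₂)) s) =ᶠ[𝓝 2] (fun s : ℂ =>
      (ℜ[c, g₂, ⌊Real.exp (2 * a₂)⌋₊ + 1, s - 1 / 2] - dslope (weilMellin (weilConv g₂ (weilReflect g₂))) 1 s) *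
        weilMellin (weilConv g₁ (weilReflect g₁)) s) := by
    have hball : Metric.ball (2 : ℂ) (1 / 2) ∈ 𝓝 (2 : ℂ) := Metric.ball_mem_nhds _ (by norm_num)
    filter_upwards [hball] with s hs
    have hs1 : 1 < s.re := by
      rw [Metric.mem_ball, Complex.dist_eq] at hs
      have h := Complex.abs_re_le_norm (s - 2)
      rw [Complex.sub_re] at h
      have : |s.re - 2| < 1 / 2 := lt_of_le_of_lt (by simpa using h) hs
      rw [abs_lt] at this
      linarith [this.1]
    rw [numerator_eq_of_one_lt hU hc hg₁ ha₁ hsupp₁ hs1, numerator_eq_of_one_lt hU hc hg₂ ha₂ hsupp₂ hs1]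
    ring
  exact hL.eqOn_of_preconnected_of_eventuallyEq hR hUc h2 hev hs

/-! ## The glued continuation -/

/-- **One holomorphic continuation of `L_c - 1/(s-1)` to `Re s > 1/2`, with the window identity.**  For `c ≥ 0`
with unit slack against every Weil test there is ONE function `F`, holomorphic on `{Re s > 1/2}`, with
`F(s) = L_c(s) - 1/(s-1)` for `Re s > 1`, such that for EVERY window `g` (`tsupport g ⊆ [-a, a]`, `a ≥ 0`,
`G = g ⋆ g̃`, `N = ⌊e^{2a}⌋ + 1`) and every `Re s > 1/2`:
`ℜ_g(s - 1/2) = F(s) M_G(s) + dslope M_G 1 s` — i.e. the Laplace side of the continuation identity keeps its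
`Re s > 1` meaning `L_c M_G - M_G(1)/(s-1) = (L_c - 1/(s-1)) M_G + (M_G(s) - M_G(1))/(s-1)` on the whole
half-plane with `L_c - 1/(s-1)` replaced by `F`. -/
theorem exists_continuation_halfPlane
    (hU : ∀ φ : ℝ → ℂ, IsWeilTest φ →
      -(∫ t, ‖φ t‖ ^ 2) ≤
        (weilPolarTerm (weilConv φ (weilReflect φ)) + weilArchTerm (weilConv φ (weilReflect φ)) -
          ∑' n : ℕ, ((c n : ℝ) : ℂ) / (Real.sqrt n : ℂ) *
            (weilConv φ (weilReflect φ) (Real.log n) + weilConv φ (weilReflect φ) (-Real.log n))).re)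
    (hc : ∀ n, 0 ≤ c n) :
    ∃ F : ℂ → ℂ, DifferentiableOn ℂ F {s : ℂ | 1 / 2 < s.re} ∧
      (∀ s : ℂ, 1 < s.re → F s = LSeries (fun n => ((c n : ℝ) : ℂ)) s - 1 / (s - 1)) ∧
      ∀ (g : ℝ → ℂ) (a : ℝ), IsWeilTest g → 0 ≤ a → tsupport g ⊆ Icc (-a) a → ∀ s : ℂ, 1 / 2 < s.re →
        ℜ[c, g, ⌊Real.exp (2 * a)⌋₊ + 1, s - 1 / 2] =
          F s * weilMellin (weilConv g (weilReflect g)) s + dslope (weilMellin (weilConv g (weilReflect g))) 1 s := by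
  -- a window with `M_G ≠ 0` near each point
  have H1 : ∀ p : ℂ, ∃ g : ℝ → ℂ, IsWeilTest g ∧ ∃ δ : ℝ, 0 < δ ∧ ∀ s : ℂ, -1 ≤ s.re → s.re ≤ p.re + 1 →
      |s.im - p.im| < δ → weilMellin (weilConv g (weilReflect g)) s ≠ 0 :=
    fun p => exists_rect_weilMellin_ne_zero p.im p.re
  choose gs hgs δs hδs hne using H1
  have H2 : ∀ p : ℂ, ∃ a : ℝ, 0 < a ∧ tsupport (gs p) ⊆ Icc (-a) a := fun p => exists_window_of_isWeilTest (hgs p)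
  choose as has hsupps using H2
  -- numerators of the chosen windows and the glued function
  set Num : ℂ → ℂ → ℂ := fun p s =>
    ℜ[c, gs p, ⌊Real.exp (2 * as p)⌋₊ + 1, s - 1 / 2] - dslope (weilMellin (weilConv (gs p) (weilReflect (gs p)))) 1 s
    with hNum
  set F : ℂ → ℂ := fun s => Num s s / weilMellin (weilConv (gs s) (weilReflect (gs s))) s with hF
  have hne_self : ∀ s : ℂ, 1 / 2 < s.re → weilMellin (weilConv (gs s) (weilReflect (gs s))) s ≠ 0 :=
    fun s hs => hne s s (by linarith) (by linarith) (by simp [hδs s])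
  -- the window identity
  have hwin : ∀ (g : ℝ → ℂ) (a : ℝ), IsWeilTest g → 0 ≤ a → tsupport g ⊆ Icc (-a) a → ∀ s : ℂ, 1 / 2 < s.re →
      ℜ[c, g, ⌊Real.exp (2 * a)⌋₊ + 1, s - 1 / 2] - dslope (weilMellin (weilConv g (weilReflect g))) 1 s =
        F s * weilMellin (weilConv g (weilReflect g)) s := by
    intro g a hg ha hsupp s hs
    have hx := numerator_cross hU hc hg ha hsupp (hgs s) (has s).le (hsupps s) hs
    have hM := hne_self s hs
    have hFs : F s = Num s s / weilMellin (weilConv (gs s) (weilReflect (gs s))) s := rfl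
    rw [hFs, div_mul_eq_mul_div, eq_div_iff hM]
    exact hx
  refine ⟨F, ?_, ?_, ?_⟩
  · -- holomorphy: near `s₀`, `F = Num s₀ / M_{G(s₀)}`
    intro s₀ hs₀
    have hs₀' : 1 / 2 < s₀.re := hs₀
    set V : Set ℂ := {s : ℂ | 1 / 2 < s.re ∧ s.re < s₀.re + 1 ∧ s₀.im - δs s₀ < s.im ∧ s.im < s₀.im + δs s₀} with hV
    have hVo : IsOpen V := by
      simp only [hV, setOf_and]
      exact (isOpen_lt continuous_const Complex.continuous_re).inter
        ((isOpen_lt Complex.continuous_re continuous_const).inter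
          ((isOpen_lt continuous_const Complex.continuous_im).inter (isOpen_lt Complex.continuous_im continuous_const)))
    have hs₀V : s₀ ∈ V := ⟨hs₀', by linarith, by linarith [hδs s₀], by linarith [hδs s₀]⟩
    have hVne : ∀ s ∈ V, weilMellin (weilConv (gs s₀) (weilReflect (gs s₀))) s ≠ 0 := by
      rintro s ⟨h1, h2, h3, h4⟩
      exact hne s₀ s (by linarith) h2.le (abs_lt.2 ⟨by linarith, by linarith⟩)
    have hGd : DifferentiableOn ℂ (fun s => Num s₀ s / weilMellin (weilConv (gs s₀) (weilReflect (gs s₀))) s) V := by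
      refine DifferentiableOn.div ?_ ?_ hVne
      · exact (differentiableOn_numerator hU (hgs s₀) (hsupps s₀) _).mono fun s hs => hs.1
      · exact (differentiable_weilMellin ((hgs s₀).weilConv (hgs s₀).weilReflect).1.continuous
          ((hgs s₀).weilConv (hgs s₀).weilReflect).2).differentiableOn
    have hEq : ∀ s ∈ V, F s = Num s₀ s / weilMellin (weilConv (gs s₀) (weilReflect (gs s₀))) s := by
      intro s hsV
      have h := hwin (gs s₀) (as s₀) (hgs s₀) (has s₀).le (hsupps s₀) s hsV.1
      rw [eq_div_iff (hVne s hsV)]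
      exact h.symm
    have hFd : DifferentiableOn ℂ F V := hGd.congr hEq
    exact (hFd.differentiableAt (hVo.mem_nhds hs₀V)).differentiableWithinAt
  · -- `F = L_c - 1/(s-1)` on `Re s > 1`
    intro s hs
    have hs' : 1 / 2 < s.re := by linarith
    have hM := hne_self s hs'
    have h := numerator_eq_of_one_lt hU hc (hgs s) (has s).le (hsupps s) hs
    simp only [hF, hNum]
    rw [div_eq_iff hM]
    exact h
  · intro g a hg ha hsupp s hs
    have h := hwin g a hg ha hsupp s hs
    rw [← h]
    ring

end Summit.RiemannHypothesis.RiemannHypothesis.Theorems.SignConeExactConeRigidity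

end
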